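import Summits.QuantumFields.BalabanUV.Gaps.D1Residue

/-!
# Gaps / D1WordwiseDrift — the WORD-BY-WORD calculus of row (D1)'s two residue shapes: drifts and one-shot laws ADD over a finite word list,
# slope-FREE words are bounded partial sums, the slopes must SUM to `stepBal N Lc`, and the law of ONE unknown word is PINNED by the total law and the
# others (cell pub-balaban-gaps, seat g1-p1 GEN 4; census rows 26 ∕ 33 of `HOME/g1/RESIDUE.md` part (D1): leaf-04 R-1 «the ghost word carries
# stepBal∕11», NOTE N-gapsg1p1-g4-2 «a per-word codim-2 `log n` is a slope share; rests must be slope-free»)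

HONEST FRAMING (cell rule, page 1 of everything): [folklore] real-sequence bookkeeping over the tree's HYPOTHESIS SHAPES `Beta.Drift.OneLoopDrift`,
`OneStepKernelFamily.D1Drift`, `Gaps.D1Residue.OneShotLaw`; nothing of Bałaban's asserted; no word decomposition of his kernels is constructed here (the
decompositions are HYPOTHESES `hdec`); (D1) NOT discharged; 0∕4 row-D1 binders; NOT `BetaPertH`, NOT the continuum limit, NOT Clay.  HONEST DEPENDENCY
(b2b cell, verbatim): «continuum YM on T⁴ ⇐ BetaPertH ∧ nine spine estimates (0/9 proved); BetaPertH ⇐ (D1) ∧ (D4) ∧ CAP+tail; G-an2-4 gates asym,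
D1 and NE2/3/4.»

WHY (located).  Road «BF-x» writes the one-shot kernel of the `m`-step composite system as a finite sum of WORDS (tadpoles, bubbles, ghost words,
rests; PART 23-hyb `D1BFx/RoadEndBFxHybS`), and two located facts of 2026-08-23 say that the universal slope is SHARED among words rather than carried
by one of them: leaf-04 g23 RESULT R-1 (pub-balaban journal l.48286: the completed unit-ray ghost word's (1.22) moment grows like `log n` with the
universal coefficient, slope ratio 0.995 — the ghost's `C_A∕3` of `11C_A∕3`, i.e. `stepBal∕11` per step; the END's `hGap` row therefore unsatisfiable
as displayed) and this seat's N-2 (l.49065, kernel anchor `Gaps/D1ReadoutCrossWeight`: for the off-diagonal read-out the per-word near-region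
obstruction starts at the codim-2 class, where it is a `log n` = a slope share).  So the road's book is kept PER WORD: each word drifts with its own
slope `c_w` (possibly 0 = a REST), and (D1) ∕ (OSL) hold iff the slopes add up to `stepBal N Lc` with the defects adding to a uniform constant.  This
file is that calculus, stated once over abstract sequences and then at the two residue shapes; it is what a consumer needs to turn «ghost word =
`stepBal∕11` + rests bounded + remaining words = `10·stepBal∕11`» into (D1), and to PIN the law of the one word nobody has computed from the total
law and the others (two-out-of-three, per word).

CONTENT (all [folklore]; no `def`):
* §1 calculus of `OneLoopDrift b A f := ∀ k, |Σ_{j<k} f j − b·k| ≤ A`: `oneLoopDrift_add`, `oneLoopDrift_neg`, `oneLoopDrift_sub`, `oneLoopDrift_sum`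
  (finite word list: slopes add, defects add), `oneLoopDrift_zero_iff` (slope `0` ⟺ bounded partial sums — a slope-free REST), `oneLoopDrift_mono`
  (a larger defect), `slope_eq_of_laws` (the one-shot-type law `∀ m ≥ 1, |g m − c·m| ≤ U` has at most one slope `c`).
* §2 (D1) word by word: **`d1Drift_of_wordwise`** — `β⁰_j = Σ_{w∈W} f_w j`, `OneLoopDrift (c w) (A w) (f w)` for each `w`, `Σ_{w∈W} c w = stepBal N Lc`
  ⟹ `D1Drift Lc Js N μ ν`; **`wordDrift_of_d1Drift_others`** — (D1) and the drifts of all words but `w₀` ⟹ the word `w₀` drifts with slope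
  `stepBal N Lc − Σ_{w ≠ w₀} c w` and defect `A + Σ_{w ≠ w₀} A w` (two out of three, per word).
* §3 (OSL) word by word: **`oneShotLaw_of_wordwise`** — `secondMoment (TshotOf Lc Jc m) μ ν = Σ_{w∈W} g_w m` (`m ≥ 1`), `|g_w m − c_w·m| ≤ U_w`,
  `Σ c_w = stepBal N Lc` ⟹ `OneShotLaw Lc Jc N μ ν`; **`wordLaw_of_oneShotLaw_others`** — the law of the one unknown word from the total law and the
  others; `wordSlope_unique` — a word obeys laws with at most one slope.
* §4 `not_bounded_of_law`, `not_partialSums_bounded_of_drift` — a word with a NONZERO slope share is not `m`-uniformly bounded (the shape of leaf-04's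
  R-1 verdict «the GAP ROW `hGap` has no m-uniform `Cgap`»: a bounded-gap row is empty as soon as the gap word carries slope).
* §5 the `D1Rep` currency (road «BF-x»'s END shape after the tower weight ∕ (J2) dictionary — d1-p2 g23 UNIT PAGE v0 §4: «(S1)(S3) applied to the
  (J2)-RESTS (raw word minus model word, whose `b_w·log n` is the model's)»): **`d1Rep_of_wordwise_matching`** (raw words matched to MODEL words
  summing to `oneShotSide`, rests bounded ⟹ `D1Rep`), **`wordRest_of_d1Rep_others`** (the rest of one word from `D1Rep` and the others).
All [folklore]; 0 sorry; 0 def; imports `Gaps.D1Residue` only.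
-/

namespace Summit.QuantumFields.BalabanUV.Gaps.D1WordwiseDrift

open Finset
open scoped BigOperators
open Literature.MathematicalPhysics.QuantumFieldTheory.Balaban1983to89
open Literature.MathematicalPhysics.QuantumFieldTheory.Balaban1983to89.Beta
open Literature.MathematicalPhysics.QuantumFieldTheory.Balaban1983to89.Beta.Drift (OneLoopDrift)
open OneStepResolventKernel (JetData)
open OneStepKernelFamily (TbalOf TshotOf D1Drift)
open B12Beta (secondMoment)
open Summit.QuantumFields.BalabanUV.Gaps.D1Residue (OneShotLaw)

/-! ## §1 The calculus of drifts over a finite word list -/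

section Calculus

variable {ι : Type*}

/-- [folklore] Drifts ADD: slopes add, defects add. -/
theorem oneLoopDrift_add {b₁ b₂ A₁ A₂ : ℝ} {f g : ℕ → ℝ} (hf : OneLoopDrift b₁ A₁ f) (hg : OneLoopDrift b₂ A₂ g) :
    OneLoopDrift (b₁ + b₂) (A₁ + A₂) (fun j => f j + g j) := by
  intro k
  have e : ∑ j ∈ range k, (f j + g j) - (b₁ + b₂) * k = (∑ j ∈ range k, f j - b₁ * k) + (∑ j ∈ range k, g j - b₂ * k) := by
    rw [sum_add_distrib]; ring
  rw [e]
  exact (abs_add_le _ _).trans (add_le_add (hf k) (hg k))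

/-- [folklore] The negative of a drifting sequence drifts with the opposite slope and the same defect. -/
theorem oneLoopDrift_neg {b A : ℝ} {f : ℕ → ℝ} (hf : OneLoopDrift b A f) : OneLoopDrift (-b) A (fun j => -f j) := by
  intro k
  have e : ∑ j ∈ range k, (-f j) - (-b) * k = -(∑ j ∈ range k, f j - b * k) := by
    rw [sum_neg_distrib]; ring
  rw [e, abs_neg]
  exact hf k

/-- [folklore] Drifts SUBTRACT. -/
theorem oneLoopDrift_sub {b₁ b₂ A₁ A₂ : ℝ} {f g : ℕ → ℝ} (hf : OneLoopDrift b₁ A₁ f) (hg : OneLoopDrift b₂ A₂ g) :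
    OneLoopDrift (b₁ - b₂) (A₁ + A₂) (fun j => f j - g j) := by
  have h := oneLoopDrift_add hf (oneLoopDrift_neg hg)
  simp only [← sub_eq_add_neg] at h
  exact h

/-- [folklore] **A FINITE WORD LIST OF DRIFTS IS A DRIFT**: slopes `Σ c_w`, defect `Σ A_w`. -/
theorem oneLoopDrift_sum (s : Finset ι) {c A : ι → ℝ} {f : ι → ℕ → ℝ} (h : ∀ w ∈ s, OneLoopDrift (c w) (A w) (f w)) :
    OneLoopDrift (∑ w ∈ s, c w) (∑ w ∈ s, A w) (fun j => ∑ w ∈ s, f w j) := by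
  classical
  induction s using Finset.induction_on with
  | empty =>
    intro k
    simp
  | @insert a s ha ih =>
    have h' := oneLoopDrift_add (h a (mem_insert_self a s)) (ih fun w hw => h w (mem_insert_of_mem hw))
    simpa only [sum_insert ha] using h'

/-- [folklore] **SLOPE ZERO ⟺ BOUNDED PARTIAL SUMS** — the shape of a slope-free REST word. -/
theorem oneLoopDrift_zero_iff {A : ℝ} {f : ℕ → ℝ} : OneLoopDrift 0 A f ↔ ∀ k : ℕ, |∑ j ∈ range k, f j| ≤ A := by
  unfold OneLoopDrift
  simp

/-- [folklore] A drift with a larger defect. -/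
theorem oneLoopDrift_mono {b A A' : ℝ} {f : ℕ → ℝ} (hf : OneLoopDrift b A f) (hA : A ≤ A') : OneLoopDrift b A' f :=
  fun k => (hf k).trans hA

/-- [folklore] **A ONE-SHOT-TYPE LAW HAS AT MOST ONE SLOPE**: `|g m − c·m| ≤ U` and `|g m − c′·m| ≤ U′` for all `m ≥ 1` force `c = c′`. -/
theorem slope_eq_of_laws {g : ℕ → ℝ} {c c' U U' : ℝ} (h : ∀ m : ℕ, 1 ≤ m → |g m - c * m| ≤ U) (h' : ∀ m : ℕ, 1 ≤ m → |g m - c' * m| ≤ U') :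
    c = c' := by
  by_contra hne
  have hpos : 0 < |c - c'| := abs_pos.mpr (sub_ne_zero.mpr hne)
  have hbd : ∀ m : ℕ, 1 ≤ m → (m : ℝ) * |c - c'| ≤ U + U' := fun m hm => by
    have e : (m : ℝ) * (c - c') = (g m - c' * m) - (g m - c * m) := by ring
    calc (m : ℝ) * |c - c'| = |(m : ℝ) * (c - c')| := by rw [abs_mul, Nat.abs_cast]
      _ = |(g m - c' * m) - (g m - c * m)| := by rw [e]
      _ ≤ |g m - c' * m| + |g m - c * m| := abs_sub _ _
      _ ≤ U' + U := add_le_add (h' m hm) (h m hm)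
      _ = U + U' := add_comm _ _
  obtain ⟨m, hm⟩ := exists_nat_gt ((U + U') / |c - c'| + 1)
  have hm1 : 1 ≤ m := by
    have : (0 : ℝ) ≤ (U + U') / |c - c'| := by
      have hU : 0 ≤ U + U' := by
        have := hbd 1 le_rfl
        simp only [Nat.cast_one, one_mul] at this
        exact hpos.le.trans this
      positivity
    exact_mod_cast (show (1 : ℝ) ≤ m by linarith)
  have := hbd m hm1
  have hk : (U + U') / |c - c'| < m := by linarith
  rw [div_lt_iff₀ hpos] at hk
  linarith

end Calculus

/-! ## §2 (D1) word by word -/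

section D1

variable {Lc : ℕ} [NeZero Lc] {ι : Type*}

/-- [folklore] **(D1) FROM A WORD LIST**: if the step coefficients `β⁰_j := secondMoment (TbalOf Lc Js j) μ ν` decompose as a finite sum of words
`Σ_{w∈W} f_w j`, each word drifting with slope `c_w` and defect `A_w`, and the slopes SUM TO `stepBal N Lc`, then `D1Drift Lc Js N μ ν`
(defect `Σ A_w`). -/
theorem d1Drift_of_wordwise (Js : ℕ → JetData 3 Lc) {N : ℝ} {μ ν : Fin 4} (s : Finset ι) {c A : ι → ℝ} {f : ι → ℕ → ℝ}
    (hdec : ∀ j : ℕ, secondMoment (TbalOf Lc Js j) μ ν = ∑ w ∈ s, f w j) (hw : ∀ w ∈ s, OneLoopDrift (c w) (A w) (f w))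
    (hsum : ∑ w ∈ s, c w = B12Normalization.stepBal N Lc) : D1Drift Lc Js N μ ν := by
  refine ⟨∑ w ∈ s, A w, ?_⟩
  have h := oneLoopDrift_sum s hw
  rw [hsum] at h
  intro k
  have e : ∑ j ∈ range k, secondMoment (TbalOf Lc Js j) μ ν = ∑ j ∈ range k, ∑ w ∈ s, f w j := sum_congr rfl fun j _ => hdec j
  rw [e]
  exact h k

/-- [folklore] **TWO OUT OF THREE, PER WORD**: (D1) (defect `A`) and the drifts of all words except `w₀` ⟹ the word `w₀` drifts with slope
`stepBal N Lc − Σ_{w ∈ W∖{w₀}} c_w` and defect `A + Σ_{w ∈ W∖{w₀}} A_w`.  (How a consumer PINS the slope share of the one word nobody has computed —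
e.g. after leaf-04's R-1 fixed the ghost word's share.) -/
theorem wordDrift_of_d1Drift_others [DecidableEq ι] (Js : ℕ → JetData 3 Lc) {N : ℝ} {μ ν : Fin 4} (s : Finset ι) {w₀ : ι} (hw₀ : w₀ ∈ s)
    {c A : ι → ℝ} {f : ι → ℕ → ℝ} {A₀ : ℝ}
    (hdec : ∀ j : ℕ, secondMoment (TbalOf Lc Js j) μ ν = ∑ w ∈ s, f w j)
    (hD : OneLoopDrift (B12Normalization.stepBal N Lc) A₀ (fun j => secondMoment (TbalOf Lc Js j) μ ν))
    (hw : ∀ w ∈ s.erase w₀, OneLoopDrift (c w) (A w) (f w)) :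
    OneLoopDrift (B12Normalization.stepBal N Lc - ∑ w ∈ s.erase w₀, c w) (A₀ + ∑ w ∈ s.erase w₀, A w) (f w₀) := by
  have hrest := oneLoopDrift_sum (s.erase w₀) hw
  have h := oneLoopDrift_sub hD hrest
  refine fun k => (le_of_eq ?_).trans (h k)
  congr 1
  have e : ∀ j, secondMoment (TbalOf Lc Js j) μ ν - ∑ w ∈ s.erase w₀, f w j = f w₀ j := fun j => by
    rw [hdec j, ← add_sum_erase s (fun w => f w j) hw₀]; ring
  simp only [e]

end D1

/-! ## §3 (OSL) word by word -/

section OSL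

variable {Lc : ℕ} [NeZero Lc] {ι : Type*}

/-- [folklore] **THE ONE-SHOT LAW FROM A WORD LIST**: if the one-shot (1.22) moment of the `m`-step composite system decomposes as `Σ_{w∈W} g_w m`
(`m ≥ 1`), each word obeying a law `|g_w m − c_w·m| ≤ U_w`, and the slopes SUM TO `stepBal N Lc`, then `OneShotLaw Lc Jc N μ ν` (constant `Σ U_w`). -/
theorem oneShotLaw_of_wordwise (Jc : ∀ m : ℕ, JetData 3 (Lc ^ m)) {N : ℝ} {μ ν : Fin 4} (s : Finset ι) {c U : ι → ℝ} {g : ι → ℕ → ℝ}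
    (hdec : ∀ m : ℕ, 1 ≤ m → secondMoment (TshotOf Lc Jc m) μ ν = ∑ w ∈ s, g w m)
    (hw : ∀ w ∈ s, ∀ m : ℕ, 1 ≤ m → |g w m - c w * m| ≤ U w) (hsum : ∑ w ∈ s, c w = B12Normalization.stepBal N Lc) :
    OneShotLaw Lc Jc N μ ν := by
  refine ⟨∑ w ∈ s, U w, fun m hm => ?_⟩
  rw [hdec m hm, ← hsum]
  have e : ∑ w ∈ s, g w m - (∑ w ∈ s, c w) * m = ∑ w ∈ s, (g w m - c w * m) := by
    rw [sum_sub_distrib, sum_mul]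
  rw [e]
  exact (abs_sum_le_sum_abs _ _).trans (sum_le_sum fun w hw' => hw w hw' m hm)

/-- [folklore] **TWO OUT OF THREE, PER WORD (one-shot form)**: the total law (constant `U₀`) and the laws of all words except `w₀` ⟹ the word `w₀`
obeys a law with slope `stepBal N Lc − Σ_{w ≠ w₀} c_w` and constant `U₀ + Σ_{w ≠ w₀} U_w`. -/
theorem wordLaw_of_oneShotLaw_others [DecidableEq ι] (Jc : ∀ m : ℕ, JetData 3 (Lc ^ m)) {N : ℝ} {μ ν : Fin 4} (s : Finset ι) {w₀ : ι}
    (hw₀ : w₀ ∈ s) {c U : ι → ℝ} {g : ι → ℕ → ℝ} {U₀ : ℝ}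
    (hdec : ∀ m : ℕ, 1 ≤ m → secondMoment (TshotOf Lc Jc m) μ ν = ∑ w ∈ s, g w m)
    (hlaw : ∀ m : ℕ, 1 ≤ m → |secondMoment (TshotOf Lc Jc m) μ ν - B12Normalization.stepBal N Lc * m| ≤ U₀)
    (hw : ∀ w ∈ s.erase w₀, ∀ m : ℕ, 1 ≤ m → |g w m - c w * m| ≤ U w) (m : ℕ) (hm : 1 ≤ m) :
    |g w₀ m - (B12Normalization.stepBal N Lc - ∑ w ∈ s.erase w₀, c w) * m| ≤ U₀ + ∑ w ∈ s.erase w₀, U w := by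
  have hsplit : g w₀ m = secondMoment (TshotOf Lc Jc m) μ ν - ∑ w ∈ s.erase w₀, g w m := by
    rw [hdec m hm, ← add_sum_erase s (fun w => g w m) hw₀]; ring
  have hrest : |∑ w ∈ s.erase w₀, g w m - (∑ w ∈ s.erase w₀, c w) * m| ≤ ∑ w ∈ s.erase w₀, U w := by
    have e : ∑ w ∈ s.erase w₀, g w m - (∑ w ∈ s.erase w₀, c w) * m = ∑ w ∈ s.erase w₀, (g w m - c w * m) := by
      rw [sum_sub_distrib, sum_mul]
    rw [e]
    exact (abs_sum_le_sum_abs _ _).trans (sum_le_sum fun w hw' => hw w hw' m hm)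
  have e : g w₀ m - (B12Normalization.stepBal N Lc - ∑ w ∈ s.erase w₀, c w) * m =
      (secondMoment (TshotOf Lc Jc m) μ ν - B12Normalization.stepBal N Lc * m) -
        (∑ w ∈ s.erase w₀, g w m - (∑ w ∈ s.erase w₀, c w) * m) := by
    rw [hsplit]; ring
  rw [e]
  exact (abs_sub _ _).trans (add_le_add (hlaw m hm) hrest)

/-- [folklore] **A WORD HAS AT MOST ONE SLOPE SHARE** (so a computed share — e.g. the ghost's `stepBal∕11` — refutes every other value for that word). -/
theorem wordSlope_unique {g : ℕ → ℝ} {c c' U U' : ℝ} (h : ∀ m : ℕ, 1 ≤ m → |g m - c * m| ≤ U)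
    (h' : ∀ m : ℕ, 1 ≤ m → |g m - c' * m| ≤ U') : c = c' :=
  slope_eq_of_laws h h'

end OSL

/-! ## §4 A word with a nonzero slope share is not uniformly bounded (the shape of leaf-04's R-1 verdict on a «bounded gap» row) -/

section Unbounded

/-- [folklore] **A LAW WITH NONZERO SLOPE EXCLUDES A UNIFORM BOUND**: if `|g m − c·m| ≤ U` for all `m ≥ 1` and `c ≠ 0`, then there is NO `C` with
`|g m| ≤ C` for all `m ≥ 1`.  (Read with `g m :=` the (1.22) moment of a word at block `Lc^m` and `c` its slope share: a displayed row asking that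
word to be `m`-uniformly bounded — the shape of road «BF-x»'s GAP ROW `hGap` — is EMPTY as soon as the word carries slope, which is what leaf-04's
R-1 measured for the completed ghost word, share `stepBal∕11`.) -/
theorem not_bounded_of_law {g : ℕ → ℝ} {c U : ℝ} (h : ∀ m : ℕ, 1 ≤ m → |g m - c * m| ≤ U) (hc : c ≠ 0) :
    ¬ ∃ C : ℝ, ∀ m : ℕ, 1 ≤ m → |g m| ≤ C := by
  rintro ⟨C, hC⟩
  -- `g` would then obey the law with slope `0` and constant `C`, contradicting the uniqueness of the slope
  have h0 : ∀ m : ℕ, 1 ≤ m → |g m - 0 * m| ≤ C := fun m hm => by simpa using hC m hm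
  exact hc (slope_eq_of_laws h h0)

/-- [folklore] The same for a drifting sequence of partial sums: `OneLoopDrift b A f` with `b ≠ 0` ⟹ the partial sums `Σ_{j<k} f j` are NOT bounded
uniformly in `k`. -/
theorem not_partialSums_bounded_of_drift {f : ℕ → ℝ} {b A : ℝ} (h : OneLoopDrift b A f) (hb : b ≠ 0) :
    ¬ ∃ C : ℝ, ∀ k : ℕ, |∑ j ∈ range k, f j| ≤ C := by
  rintro ⟨C, hC⟩
  have h0 : OneLoopDrift 0 C f := oneLoopDrift_zero_iff.mpr hC
  exact hb (D1Residue.oneLoopDrift_slope_unique h h0)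

end Unbounded

/-! ## §5 The `D1Rep` currency word by word: raw words matched to MODEL words that sum to the free one-shot side -/

section Matching

open OneStepKernelFamily (D1Rep)
open ScalewiseVectorSeam (oneShotSide)

variable {Lc : ℕ} [NeZero Lc] {ι : Type*} {L : Type*}

/-- [folklore] **`D1Rep` FROM A WORD-BY-WORD MATCHING** (the shape of road «BF-x»'s END after the tower weight ∕ (J2) dictionary: «raw word minus
model word» bounded per word, the model words summing to the free one-shot side): if `secondMoment (TshotOf Lc Jc m) μ ν = Σ_{w∈W} g_w m` (`m ≥ 1`),
`Σ_{w∈W} model_w m = oneShotSide SL μ ν N a k (Lc^m)` and `|g_w m − model_w m| ≤ U_w` for every word, then `D1Rep Lc Jc N μ ν a SL k` (constant `Σ U_w`).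
Each word's slope share then sits in its MODEL word; the RESTS `g_w − model_w` are slope-free by hypothesis. -/
theorem d1Rep_of_wordwise_matching (Jc : ∀ m : ℕ, JetData 3 (Lc ^ m)) {N : ℝ} {μ ν : Fin 4} {a : ℝ} {SL : Finset L} {k : L → Fin 4}
    (s : Finset ι) {g model : ι → ℕ → ℝ} {U : ι → ℝ}
    (hdec : ∀ m : ℕ, 1 ≤ m → secondMoment (TshotOf Lc Jc m) μ ν = ∑ w ∈ s, g w m)
    (hmodel : ∀ m : ℕ, 1 ≤ m → ∑ w ∈ s, model w m = oneShotSide SL μ ν N a k (Lc ^ m))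
    (hrest : ∀ w ∈ s, ∀ m : ℕ, 1 ≤ m → |g w m - model w m| ≤ U w) :
    D1Rep Lc Jc N μ ν a SL k := by
  refine ⟨∑ w ∈ s, U w, fun m hm => ?_⟩
  rw [hdec m hm, ← hmodel m hm, ← sum_sub_distrib]
  exact (abs_sum_le_sum_abs _ _).trans (sum_le_sum fun w hw => hrest w hw m hm)

/-- [folklore] **THE REST OF ONE WORD FROM `D1Rep` AND THE OTHERS**: `D1Rep` (constant `U₀`) + the matching of all words except `w₀` ⟹ the rest of `w₀`
is bounded, `|g_{w₀} m − model_{w₀} m| ≤ U₀ + Σ_{w ≠ w₀} U_w` (two out of three, per word, in the `D1Rep` currency). -/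
theorem wordRest_of_d1Rep_others [DecidableEq ι] (Jc : ∀ m : ℕ, JetData 3 (Lc ^ m)) {N : ℝ} {μ ν : Fin 4} {a : ℝ} {SL : Finset L}
    {k : L → Fin 4} (s : Finset ι) {w₀ : ι} (hw₀ : w₀ ∈ s) {g model : ι → ℕ → ℝ} {U : ι → ℝ} {U₀ : ℝ}
    (hdec : ∀ m : ℕ, 1 ≤ m → secondMoment (TshotOf Lc Jc m) μ ν = ∑ w ∈ s, g w m)
    (hmodel : ∀ m : ℕ, 1 ≤ m → ∑ w ∈ s, model w m = oneShotSide SL μ ν N a k (Lc ^ m))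
    (hrep : ∀ m : ℕ, 1 ≤ m → |secondMoment (TshotOf Lc Jc m) μ ν - oneShotSide SL μ ν N a k (Lc ^ m)| ≤ U₀)
    (hrest : ∀ w ∈ s.erase w₀, ∀ m : ℕ, 1 ≤ m → |g w m - model w m| ≤ U w) (m : ℕ) (hm : 1 ≤ m) :
    |g w₀ m - model w₀ m| ≤ U₀ + ∑ w ∈ s.erase w₀, U w := by
  have htot : secondMoment (TshotOf Lc Jc m) μ ν - oneShotSide SL μ ν N a k (Lc ^ m) = ∑ w ∈ s, (g w m - model w m) := by
    rw [hdec m hm, ← hmodel m hm, sum_sub_distrib]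
  have hsplit : g w₀ m - model w₀ m = (∑ w ∈ s, (g w m - model w m)) - ∑ w ∈ s.erase w₀, (g w m - model w m) := by
    rw [← add_sum_erase s (fun w => g w m - model w m) hw₀]; ring
  have hothers : |∑ w ∈ s.erase w₀, (g w m - model w m)| ≤ ∑ w ∈ s.erase w₀, U w :=
    (abs_sum_le_sum_abs _ _).trans (sum_le_sum fun w hw => hrest w hw m hm)
  rw [hsplit, ← htot]
  exact (abs_sub _ _).trans (add_le_add (hrep m hm) hothers)

end Matching

end Summit.QuantumFields.BalabanUV.Gaps.D1WordwiseDrift
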